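import Literature.Topology.PlanarFoliations.Punctures
import HarnessLib

/-!
# Limit sets of leaves of a punctured planar foliation (Poincaré–Bendixson trichotomy)

Topic: Topology / PlanarFoliations, sequel to `OmegaLimit.lean`, `Reverse.lean`, `Kneser.lean`,
`Punctures.lean`. For an open leaf `L` of a bi-oriented foliation of a plane domain `X ↪ ℂ`
whose points lie in a compact set `C`:

* `isPreconnected_omegaSet` (+ α) (**proved**): **the ω-limit set is connected** (a nested
  intersection of continua, via Cantor: `exists_image_fwd_subset`).
* `closure_image_leaf` (**proved**): `closure ι(L) = ι(L) ∪ ω(L) ∪ α(L)`.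

and in the setting of `PunctureData` (finitely many punctures, a foliated map, finitely many
level leaves at each puncture), with `C ⊆ Ω`:

* `exists_omegaSet_eq_singleton` (**proved**): **if `ω(L)` consists of punctures it is a single
  puncture** (the forward half-leaf eventually lies in a union of small disjoint balls, and is
  connected), and then `L` is a level leaf of that puncture
  (`exists_mem_levelLeaves_of_omegaSet_subset`, `Punctures.lean`); likewise for `α`.
* `isCompact_or_subset_of_mem_omegaSet` (**proved**): **a regular ω-limit leaf `L_y ⊆ ω(L)` is
  either compact (a closed leaf) or a separatrix**: open, with `ω(L_y)` and `α(L_y)` single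
  punctures and `L_y` among the finitely many level leaves (`not_mem_omegaSet_of_mem_omegaSet`,
  `not_mem_alphaSet_of_mem_omegaSet`). With `exists_omegaSet_eq_singleton` this is the
  Poincaré–Bendixson trichotomy for foliations with finitely many singularities: the ω-limit set
  of a leaf is a closed leaf, a single singular point, or consists of singular points and
  separatrices joining them (Camacho–Lins Neto, Ch. VI §4: "ω(γ) can only be a singularity, a
  closed orbit or a graph").

All statements are [folklore].
-/

noncomputable section

open Set Filter Function Bornology Metric
open _root_.Topology
open Literature.Topology.FourManifolds Literature.Topology.FourManifolds.Foliation
  Literature.Topology.FourManifolds.OneManifold Literature.Topology.PlaneTopology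

namespace Literature.Topology.PlanarFoliations

variable {X : Type*} [TopologicalSpace X] [T2Space X] [SecondCountableTopology X] {F : Foliation ℝ X} {x : X}
variable [NoncompactSpace (F.Leaf x)] {hbi : IsBiOriented F} {ι : X → ℂ}
variable {B : Type*} [TopologicalSpace B] {M : Type*} [TopologicalSpace M] {T : Foliation B M} {g : ℂ → M}

/-! ## The ω-limit set is connected -/

/-- **The ω-limit set of a leaf in a compact set is preconnected.** If it were split by two
disjoint closed sets, these would have disjoint open neighbourhoods (compactness), the forward
half-leaf would eventually lie in their union (`exists_image_fwd_subset`), hence, being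
connected, in one of them, and the ω-limit set would miss the other. [folklore] -/
theorem isPreconnected_omegaSet (hι : IsOpenEmbedding ι) {C : Set ℂ} (hC : IsCompact C)
    (hmem : ∀ q : F.Leaf x, ι (Leaf.pt q) ∈ C) : IsPreconnected (omegaSet hbi ι x) := by
  have hωC : omegaSet hbi ι x ⊆ C := omegaSet_subset_of_forall_mem hC.isClosed hmem
  have hωc : IsCompact (omegaSet hbi ι x) := hC.of_isClosed_subset isClosed_omegaSet hωC
  rw [isPreconnected_iff_subset_of_disjoint_closed]
  intro u v hu hv hsub hdisj
  set A := omegaSet hbi ι x ∩ u with hA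
  set B' := omegaSet hbi ι x ∩ v with hB'
  have hAc : IsCompact A := hωc.inter_right hu
  have hBc : IsCompact B' := hωc.inter_right hv
  have hAB : Disjoint A B' := by
    rw [disjoint_iff_inter_eq_empty]
    apply eq_empty_of_forall_notMem
    rintro z ⟨⟨hz, hzu⟩, -, hzv⟩
    have : z ∈ omegaSet hbi ι x ∩ (u ∩ v) := ⟨hz, hzu, hzv⟩
    rw [hdisj] at this
    exact this
  obtain ⟨U, V, hUo, hVo, hAU, hBV, hUV⟩ := SeparatedNhds.of_isCompact_isCompact hAc hBc hAB
  have hωUV : omegaSet hbi ι x ⊆ U ∪ V := fun z hz ↦ by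
    rcases hsub hz with h | h
    · exact Or.inl (hAU ⟨hz, h⟩)
    · exact Or.inr (hBV ⟨hz, h⟩)
  obtain ⟨p, hp⟩ := PunctureData.exists_image_fwd_subset hC hmem (hUo.union hVo) hωUV
  have hconn : IsPreconnected ((fun q : F.Leaf x ↦ ι (Leaf.pt q)) '' fwd hbi p) :=
    (PunctureData.isPreconnected_fwd p).image _ ((hι.continuous.comp (Leaf.continuous_coe F x)).continuousOn)
  have hωcl : omegaSet hbi ι x ⊆ closure ((fun q : F.Leaf x ↦ ι (Leaf.pt q)) '' fwd hbi p) :=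
    iInter_subset _ p
  have hUcl : Disjoint (closure U) V := hUV.closure_left hVo
  have hVcl : Disjoint U (closure V) := hUV.closure_right hUo
  rcases hconn.subset_or_subset hUo hVo hUV hp with h | h
  · left
    intro z hz
    rcases hsub hz with hzu | hzv
    · exact hzu
    · exact absurd (hBV ⟨hz, hzv⟩) (disjoint_left.1 hUcl (closure_mono h (hωcl hz)))
  · right
    intro z hz
    rcases hsub hz with hzu | hzv
    · exact absurd (hAU ⟨hz, hzu⟩) (disjoint_right.1 hVcl (closure_mono h (hωcl hz)))
    · exact hzv

/-- **The α-limit set of a leaf in a compact set is preconnected.** [folklore] -/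
theorem isPreconnected_alphaSet (hι : IsOpenEmbedding ι) {C : Set ℂ} (hC : IsCompact C)
    (hmem : ∀ q : F.Leaf x, ι (Leaf.pt q) ∈ C) : IsPreconnected (alphaSet hbi ι x) := by
  rw [alphaSet_eq_omegaSet_flip]
  exact isPreconnected_omegaSet (hbi := isBiOriented_flip hbi) hι hC fun q ↦ hmem ((Leaf.toFlip x).symm q)

/-! ## The closure of a leaf -/

/-- **The closure of an open leaf is the leaf together with its ω- and α-limit sets.** A point
of the closure off the leaf is missed by a compact middle piece `[p', p]` of the leaf, hence is
in the closure of a forward or a backward half-leaf, for every choice of these. [folklore] -/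
theorem closure_image_leaf (hι : IsOpenEmbedding ι) :
    closure (ι '' F.leaf x) = ι '' F.leaf x ∪ omegaSet hbi ι x ∪ alphaSet hbi ι x := by
  have himg : ι '' F.leaf x = range fun q : F.Leaf x ↦ ι (Leaf.pt q) := image_leaf_eq_range x
  have hc : Continuous fun q : F.Leaf x ↦ ι (Leaf.pt q) := hι.continuous.comp (Leaf.continuous_coe F x)
  apply Subset.antisymm
  · intro z hz
    by_contra hzn
    simp only [mem_union, not_or] at hzn
    obtain ⟨⟨hzL, hzω⟩, hzα⟩ := hzn
    -- half-leaves missing `z`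
    obtain ⟨p, hp⟩ : ∃ p : F.Leaf x, z ∉ closure ((fun q : F.Leaf x ↦ ι (Leaf.pt q)) '' fwd hbi p) :=
      not_forall.1 (mt mem_omegaSet_iff.2 hzω)
    obtain ⟨p', hp'⟩ : ∃ p' : F.Leaf x, z ∉ closure ((fun q : F.Leaf x ↦ ι (Leaf.pt q)) '' bwd hbi p') :=
      not_forall.1 (mt mem_alphaSet_iff.2 hzα)
    -- the leaf is covered by `bwd p'`, a compact middle piece, and `fwd p`
    have hcover : ∀ q : F.Leaf x, q ∈ bwd hbi p' ∨ q ∈ leafIcc hbi p' p ∪ leafIcc hbi p p' ∨ q ∈ fwd hbi p := by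
      intro q
      by_cases h₁ : leafLT hbi p' q
      · by_cases h₂ : leafLT hbi q p
        · exact Or.inr (Or.inl (Or.inl ⟨leafLT_asymm h₁, leafLT_asymm h₂⟩))
        · exact Or.inr (Or.inr h₂)
      · exact Or.inl h₁
    set K : Set ℂ := (fun q : F.Leaf x ↦ ι (Leaf.pt q)) '' (leafIcc hbi p' p ∪ leafIcc hbi p p') with hK
    have hKc : IsClosed K := (((isCompact_leafIcc p' p).union (isCompact_leafIcc p p')).image hc).isClosed
    have hzK : z ∉ K := by
      rintro ⟨q, -, rfl⟩
      exact hzL (by rw [himg]; exact ⟨q, rfl⟩)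
    have hsub : ι '' F.leaf x ⊆ closure ((fun q : F.Leaf x ↦ ι (Leaf.pt q)) '' bwd hbi p') ∪ K ∪
        closure ((fun q : F.Leaf x ↦ ι (Leaf.pt q)) '' fwd hbi p) := by
      rw [himg]
      rintro _ ⟨q, rfl⟩
      rcases hcover q with h | h | h
      · exact Or.inl (Or.inl (subset_closure ⟨q, h, rfl⟩))
      · exact Or.inl (Or.inr ⟨q, h, rfl⟩)
      · exact Or.inr (subset_closure ⟨q, h, rfl⟩)
    have hcl : IsClosed (closure ((fun q : F.Leaf x ↦ ι (Leaf.pt q)) '' bwd hbi p') ∪ K ∪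
        closure ((fun q : F.Leaf x ↦ ι (Leaf.pt q)) '' fwd hbi p)) :=
      (isClosed_closure.union hKc).union isClosed_closure
    rcases (hcl.closure_subset_iff.2 hsub) hz with (h | h) | h
    · exact hp' h
    · exact hzK h
    · exact hp h
  · refine union_subset (union_subset subset_closure ?_) ?_
    · exact (iInter_subset _ (Leaf.base F x)).trans (closure_mono (image_subset_iff.2 fun q _ ↦ by
        rw [himg]; exact ⟨q, rfl⟩))
    · exact (iInter_subset _ (Leaf.base F x)).trans (closure_mono (image_subset_iff.2 fun q _ ↦ by
        rw [himg]; exact ⟨q, rfl⟩))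

/-! ## Limit sets consisting of punctures -/

namespace PunctureData

variable (D : PunctureData F ι T g)

omit [T2Space X] [SecondCountableTopology X] [NoncompactSpace (F.Leaf x)] in
/-- The half-radius balls around distinct punctures are disjoint. [folklore] -/
theorem eq_of_mem_ball_half {v v' : ℂ} (hv : v ∈ D.P) (hv' : v' ∈ D.P) {z : ℂ} (hz : z ∈ ball v (D.rad v / 2))
    (hz' : z ∈ ball v' (D.rad v' / 2)) : v = v' := by
  rw [mem_ball] at hz hz'
  have htri : dist v v' ≤ dist z v + dist z v' := by rw [dist_comm z v]; exact dist_triangle v z v'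
  rcases le_total (D.rad v) (D.rad v') with h | h
  · exact D.eq_of_mem_ball v' hv' v hv (by rw [mem_ball]; linarith)
  · exact (D.eq_of_mem_ball v hv v' hv' (by rw [mem_ball, dist_comm]; linarith)).symm

omit [T2Space X] [SecondCountableTopology X] [NoncompactSpace (F.Leaf x)] in
/-- **A limit set made of punctures, inside the closure of a connected set of leaf points lying
in the union of the half-balls, is a single puncture.** [folklore] -/
theorem subset_singleton_of_subset_P {A Λ : Set ℂ} (hA : IsPreconnected A) (hAne : A.Nonempty)
    (hAU : A ⊆ ⋃ v ∈ D.P, ball v (D.rad v / 2)) (hΛA : Λ ⊆ closure A) (hΛP : Λ ⊆ D.P) :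
    ∃ v₁ ∈ D.P, Λ ⊆ {v₁} := by
  obtain ⟨a, ha⟩ := hAne
  obtain ⟨v₁, hv₁, hav₁⟩ : ∃ v₁ ∈ D.P, a ∈ ball v₁ (D.rad v₁ / 2) := by
    have h := hAU ha
    rw [mem_iUnion₂] at h
    obtain ⟨v₁, hv₁, h⟩ := h
    exact ⟨v₁, hv₁, h⟩
  set V₁ := ball v₁ (D.rad v₁ / 2) with hV₁
  set V₂ : Set ℂ := ⋃ v ∈ D.P \ {v₁}, ball v (D.rad v / 2) with hV₂
  have hV₂o : IsOpen V₂ := isOpen_biUnion fun _ _ ↦ isOpen_ball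
  have hV₁₂ : Disjoint V₁ V₂ := by
    rw [disjoint_left]
    intro z hz₁ hz₂
    rw [hV₂, mem_iUnion₂] at hz₂
    obtain ⟨v, ⟨hv, hvne⟩, hz⟩ := hz₂
    exact hvne (D.eq_of_mem_ball_half hv hv₁ hz hz₁)
  have hUsub : (⋃ v ∈ D.P, ball v (D.rad v / 2)) ⊆ V₁ ∪ V₂ := fun z hz ↦ by
    rw [mem_iUnion₂] at hz
    obtain ⟨v, hv, hz⟩ := hz
    by_cases hvv : v = v₁
    · subst hvv; exact Or.inl hz
    · exact Or.inr (mem_biUnion ⟨hv, hvv⟩ hz)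
  have hAV₁ : A ⊆ V₁ := hA.subset_left_of_subset_union isOpen_ball hV₂o hV₁₂ (hAU.trans hUsub) ⟨a, ha, hav₁⟩
  have hr₁ := D.rad_pos v₁ hv₁
  refine ⟨v₁, hv₁, fun z hz ↦ ?_⟩
  have hzcl : z ∈ closedBall v₁ (D.rad v₁ / 2) := by
    rw [← closure_ball v₁ (by linarith : D.rad v₁ / 2 ≠ 0)]
    exact closure_mono hAV₁ (hΛA hz)
  exact (D.eq_of_mem_ball v₁ hv₁ z (hΛP hz) (closedBall_subset_ball (by linarith) hzcl))

/-- **An ω-limit set consisting of punctures is a single puncture**, and the leaf is one of its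
level leaves. [folklore] -/
theorem exists_omegaSet_eq_singleton (hι : IsOpenEmbedding ι) {C : Set ℂ} (hC : IsCompact C)
    (hmem : ∀ q : F.Leaf x, ι (Leaf.pt q) ∈ C) (hω : omegaSet hbi ι x ⊆ D.P) :
    ∃ v ∈ D.P, omegaSet hbi ι x = {v} ∧ ∃ s ∈ D.levelLeaves v, x ∈ F.leaf s := by
  set U : Set ℂ := ⋃ v ∈ D.P, ball v (D.rad v / 2) with hU
  have hUo : IsOpen U := isOpen_biUnion fun _ _ ↦ isOpen_ball
  have hωU : omegaSet hbi ι x ⊆ U := fun z hz ↦ mem_biUnion (hω hz) (mem_ball_self (by linarith [D.rad_pos z (hω hz)]))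
  obtain ⟨p, hp⟩ := PunctureData.exists_image_fwd_subset hC hmem hUo hωU
  have hconn : IsPreconnected ((fun q : F.Leaf x ↦ ι (Leaf.pt q)) '' fwd hbi p) :=
    (PunctureData.isPreconnected_fwd p).image _ ((hι.continuous.comp (Leaf.continuous_coe F x)).continuousOn)
  obtain ⟨v₁, hv₁, hωv₁⟩ := D.subset_singleton_of_subset_P hconn ⟨_, ⟨p, mem_fwd_self p, rfl⟩⟩ hp
    (iInter_subset _ p) hω
  obtain ⟨z₀, hz₀⟩ := omegaSet_nonempty_of_forall_mem (hbi := hbi) hC hmem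
  have hz₀v : z₀ = v₁ := hωv₁ hz₀
  exact ⟨v₁, hv₁, Subset.antisymm hωv₁ (by rw [singleton_subset_iff, ← hz₀v]; exact hz₀),
    D.exists_mem_levelLeaves_of_omegaSet_subset hv₁ hC hmem hωv₁⟩

/-- **An α-limit set consisting of punctures is a single puncture**, and the leaf is one of its
level leaves. [folklore] -/
theorem exists_alphaSet_eq_singleton (hι : IsOpenEmbedding ι) {C : Set ℂ} (hC : IsCompact C)
    (hmem : ∀ q : F.Leaf x, ι (Leaf.pt q) ∈ C) (hα : alphaSet hbi ι x ⊆ D.P) :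
    ∃ v ∈ D.P, alphaSet hbi ι x = {v} ∧ ∃ s ∈ D.levelLeaves v, x ∈ F.leaf s := by
  set U : Set ℂ := ⋃ v ∈ D.P, ball v (D.rad v / 2) with hU
  have hUo : IsOpen U := isOpen_biUnion fun _ _ ↦ isOpen_ball
  have hαU : alphaSet hbi ι x ⊆ U := fun z hz ↦ mem_biUnion (hα hz) (mem_ball_self (by linarith [D.rad_pos z (hα hz)]))
  obtain ⟨p, hp⟩ := PunctureData.exists_image_bwd_subset hC hmem hUo hαU
  have hconn : IsPreconnected ((fun q : F.Leaf x ↦ ι (Leaf.pt q)) '' bwd hbi p) :=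
    (PunctureData.isPreconnected_bwd p).image _ ((hι.continuous.comp (Leaf.continuous_coe F x)).continuousOn)
  obtain ⟨v₁, hv₁, hαv₁⟩ := D.subset_singleton_of_subset_P hconn ⟨_, ⟨p, mem_bwd_self p, rfl⟩⟩ hp
    (iInter_subset _ p) hα
  obtain ⟨z₀, hz₀⟩ := alphaSet_nonempty_of_forall_mem (hbi := hbi) hC hmem
  have hz₀v : z₀ = v₁ := hαv₁ hz₀
  exact ⟨v₁, hv₁, Subset.antisymm hαv₁ (by rw [singleton_subset_iff, ← hz₀v]; exact hz₀),
    D.exists_mem_levelLeaves_of_alphaSet_subset hv₁ hC hmem hαv₁⟩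

/-! ## Regular ω-limit leaves: closed leaves or separatrices -/

/-- **A regular ω-limit leaf is compact or a separatrix.** Let the points of the open leaf `L`
lie in a compact set `C ⊆ Ω` and let `y` be a point of the domain with `ι y ∈ ω(L)`. Then the
leaf of `y` is compact, or it is open and both its limit sets are single punctures, so that it
is one of the finitely many level leaves of each. [folklore] -/
theorem isCompact_or_of_mem_omegaSet (hι : IsOpenEmbedding ι) {C : Set ℂ} (hC : IsCompact C) (hCΩ : C ⊆ D.Ω)
    (hmem : ∀ q : F.Leaf x, ι (Leaf.pt q) ∈ C) {y : X} (hy : ι y ∈ omegaSet hbi ι x) :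
    IsCompact (F.leaf y) ∨ ∃ _ : NoncompactSpace (F.Leaf y),
      (∃ v ∈ D.P, omegaSet hbi ι y = {v} ∧ ∃ s ∈ D.levelLeaves v, y ∈ F.leaf s) ∧
      (∃ v ∈ D.P, alphaSet hbi ι y = {v} ∧ ∃ s ∈ D.levelLeaves v, y ∈ F.leaf s) := by
  by_cases hcy : IsCompact (F.leaf y)
  · exact Or.inl hcy
  · haveI := noncompactSpace_leaf_of_not_isCompact' hcy
    -- the points of `L_y` are in `ω(L) ⊆ C`
    have hωC : omegaSet hbi ι x ⊆ C := omegaSet_subset_of_forall_mem hC.isClosed hmem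
    have hmemy : ∀ q : F.Leaf y, ι (Leaf.pt q) ∈ C := fun q ↦ hωC (mem_omegaSet_of_mem_leaf hι hy q.2)
    -- its limit sets contain no point of the domain, hence consist of punctures
    have hP : ∀ {z}, z ∈ C → z ∉ range ι → z ∈ D.P := fun {z} hz hzr ↦ by
      by_contra hzP
      exact hzr (D.mem_range (hCΩ hz) hzP)
    have hωP : omegaSet hbi ι y ⊆ D.P := fun z hz ↦ hP (omegaSet_subset_of_forall_mem hC.isClosed hmemy hz) (by
      rintro ⟨y', rfl⟩; exact not_mem_omegaSet_of_mem_omegaSet hι hy y' hz)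
    have hαP : alphaSet hbi ι y ⊆ D.P := fun z hz ↦ hP (alphaSet_subset_of_forall_mem hC.isClosed hmemy hz) (by
      rintro ⟨y', rfl⟩; exact not_mem_alphaSet_of_mem_omegaSet hι hy y' hz)
    exact Or.inr ⟨inferInstance, D.exists_omegaSet_eq_singleton hι hC hmemy hωP, D.exists_alphaSet_eq_singleton hι hC hmemy hαP⟩

/-- **A regular α-limit leaf is compact or a separatrix.** [folklore] -/
theorem isCompact_or_of_mem_alphaSet (hι : IsOpenEmbedding ι) {C : Set ℂ} (hC : IsCompact C) (hCΩ : C ⊆ D.Ω)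
    (hmem : ∀ q : F.Leaf x, ι (Leaf.pt q) ∈ C) {y : X} (hy : ι y ∈ alphaSet hbi ι x) :
    IsCompact (F.leaf y) ∨ ∃ _ : NoncompactSpace (F.Leaf y),
      (∃ v ∈ D.P, omegaSet hbi ι y = {v} ∧ ∃ s ∈ D.levelLeaves v, y ∈ F.leaf s) ∧
      (∃ v ∈ D.P, alphaSet hbi ι y = {v} ∧ ∃ s ∈ D.levelLeaves v, y ∈ F.leaf s) := by
  by_cases hcy : IsCompact (F.leaf y)
  · exact Or.inl hcy
  · haveI := noncompactSpace_leaf_of_not_isCompact' hcy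
    have hαC : alphaSet hbi ι x ⊆ C := alphaSet_subset_of_forall_mem hC.isClosed hmem
    have hmemy : ∀ q : F.Leaf y, ι (Leaf.pt q) ∈ C := fun q ↦ hαC (mem_alphaSet_of_mem_leaf hι hy q.2)
    have hP : ∀ {z}, z ∈ C → z ∉ range ι → z ∈ D.P := fun {z} hz hzr ↦ by
      by_contra hzP
      exact hzr (D.mem_range (hCΩ hz) hzP)
    have hωP : omegaSet hbi ι y ⊆ D.P := fun z hz ↦ hP (omegaSet_subset_of_forall_mem hC.isClosed hmemy hz) (by
      rintro ⟨y', rfl⟩; exact not_mem_omegaSet_of_mem_alphaSet hι hy y' hz)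
    have hαP : alphaSet hbi ι y ⊆ D.P := fun z hz ↦ hP (alphaSet_subset_of_forall_mem hC.isClosed hmemy hz) (by
      rintro ⟨y', rfl⟩; exact not_mem_alphaSet_of_mem_alphaSet hι hy y' hz)
    exact Or.inr ⟨inferInstance, D.exists_omegaSet_eq_singleton hι hC hmemy hωP, D.exists_alphaSet_eq_singleton hι hC hmemy hαP⟩

end PunctureData

end Literature.Topology.PlanarFoliations
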